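import Summits.BirchSwinnertonDyer.BirchSwinnertonDyer.Theorems.TwoAdicConverseBDPAcLineOrdinaryShape
import Literature.NumberTheory.EllipticCurves.AnticyclotomicInertiaAbovePAnyPrime
import Literature.GroupTheory.ProcyclicModNormalKernelGenerator
import Literature.NumberTheory.GaloisRepresentations.LocalHOneInertiaRestrictionProfinite
import Literature.NumberTheory.GaloisRepresentations.LocalGaloisGroupFrobeniusProofs
import HarnessLib

/-!
# AC-LINE COINVARIANT DATUM (part I): the door hypothesis `hgen` is a KERNEL THEOREM — `ker κ₂ ∩ D_{v̄}` is
# topologically generated by a Frobenius power modulo `I′ = Gal(K̄/K̃_∞) ∩ I_{v̄}` — and the inertial `τ` with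
# `χ₂(τ) = -1` fixing `K̃_∞` (crux `BDPSelmerLowerDivisibilityAtTwo`, stmt-BirchSwinnertonDyer-24728; route
# `TwoAdicConverse`, S3)

Helper file `--supports stmt-BirchSwinnertonDyer-24728` (cell `bsd-2adic`, seat `bsd-2adic-tower-1` GEN 55; key
«PRINT-LEVEL RESIDUALS», director-bsd (674)(A), pen RC-660/661, SUMMON 20260830T211123Z). THEOREMS ONLY (no
definition, no named fact, no instance, no `sorry`).

GEN 54 (`…AcLineCoinvariantControl`, `…AcLineOrdinaryShape`) left the door `X_Gr₂ ⧸ T₁ → 𝔛_ac` — and with it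
NONDEG₀ / BUDGET / the (e15) inequality `1 + a ≤ k + m` at (β) — modulo two DISPLAYED local hypotheses at the prime
`v̄ ∣ 2` of the imaginary quadratic field `K` (2 split, `κ₂` anticyclotomic):

* `hgen : κ₂.kerSubgroup ⊓ decomp v̄ ≤ cl ⟨φ, pairKer κ₁ κ₂ ⊓ inertia v̄⟩` for some `φ ∈ ker κ₂ ∩ D_{v̄}`;
* `hord` (ordinary shape, with an inertial `τ ∈ pairKer κ₁ κ₂ ⊓ inertia v̄` acting by `-1` on `Ê[2^∞]`).

The SUMMON asked for these «modulo ≤ 4 named print facts».  The tree search of this gen found ALL the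
class-field-theoretic inputs PROVED in the tree — `dense_absInertia_mul_zpowers_of_isFrobPow` (`I_F·⟨Frob⟩` dense
in `Γ_F`, NSW 7.5.3), `Literature.GroupTheory.exists_pow_mem_closure_inter_eq` (open subgroups of a procyclic
group `cl⟨t̄⟩` are `cl⟨t̄^m⟩`, Ribes–Zalesskii §2.7), the local Kronecker–Weber theorem in inertia form
(`adicCompletion_rat_exists_eq_comp_cyclotomicCharacter_of_mem_absInertia`, Serre LF XIV §7 Thm. 2) with
`χ_p(I_{ℚ_p}) = ℤ_pˣ`, and the global «`K̃_∞/K_∞⁻` unramified above a split `p`» for ODD `p`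
(`AnticyclotomicInertiaAboveP`).  Two Literature files of this gen close the gap at `p = 2`
(`Literature/GroupTheory/ProcyclicModNormalKernelGenerator.lean`, p792325;
`Literature/NumberTheory/EllipticCurves/AnticyclotomicInertiaAbovePAnyPrime.lean`, p792410), so that HERE:

* ★ `acLineFrobeniusGenerates` — **`hgen` UNCONDITIONALLY**, any prime `p`: for `K` imaginary quadratic, `p`
  split (`v ≠ v̄` above `p`), `κ₂` anticyclotomic and ANY `κ₁`, there is `φ ∈ ker κ₂ ∩ D_{v̄}`, the restriction of
  a local element `φ₀ ∈ Γ_{K_{v̄}}` which is a FROBENIUS POWER OF POSITIVE DEGREE `m` (`IsFrobPow φ₀ m`), with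
  `κ₂.kerSubgroup ⊓ decomp v̄ ≤ cl(Subgroup.closure ({φ} ∪ (pairKer κ₁ κ₂ ⊓ inertia v̄)))`.  Proof: in `Γ_{K_{v̄}}`
  with `N = I`, `t` an arithmetic Frobenius and `λ = κ₂ ∘ res` (ramified on `I` by Brink's Cor. 1 in inertia
  form, `exists_mem_greenbergSelmer_inertia_apply_ne_one_of_isAnticyclotomic`), the abstract
  `exists_ker_le_topologicalClosure_zpowers_sup_inf` gives `φ₀ = t^m ι⁻¹ ∈ ker λ` with
  `ker λ ≤ cl(⟨φ₀⟩(ker λ ⊓ I))`; push forward along the continuous `res : Γ_{K_{v̄}} → Γ_K` (image `D_{v̄}`,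
  `res(I) = inertia v̄`) and use `inertia v̄ ⊓ ker κ₂ ≤ ker κ₁`
  (`greenbergSelmer_inertia_inf_kerSubgroup_le_kerSubgroup_of_isAnticyclotomic`) to land in `pairKer`.
  `acLineFrobeniusGeneratesAtTwo` is the `p = 2` reading in the letter of GEN 54's `hgen`.
* ★ `exists_mem_pairKer_inf_inertia_cyclotomicCharacter_eq_neg_one` — the (hτ) half of `hord` on the GALOIS
  side, unconditionally: `∃ τ, τ ∈ pairKer κ₁ κ₂ ∧ τ ∈ inertia v̄ ∧ χ₂(τ) = -1` (any quadratic `K` with `v ≠ v̄`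
  above `2`; every `p`: torsion units of `ℤ_pˣ`).

What REMAINS displayed after this file is the CURVE side of `hord` only (Tate's ordinary filtration at `v̄`:
`I_{v̄}` acts on `Ê[2^∞]` through `χ₂`, `D_{v̄}` acts on `E[2^∞]/Ê[2^∞]` through an unramified character of
infinite order on Frobenius) — part II.  HONEST LABELS: nothing here closes the crux; the count of record of O2
does not move; BSD is proved for no curve by any of this; typed ≠ proved — except that `hgen` IS now proved.
-/

-- D-0017: single-problem summit, the namespace repeats the problem name by design.
set_option linter.dupNamespace false
set_option autoImplicit false

noncomputable section

open scoped Classical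

open NumberField IsDedekindDomain Field WeierstrassCurve
open Literature.NumberTheory.EllipticCurves Literature.NumberTheory.GaloisRepresentations
  Literature.NumberTheory.EllipticCurves.GreenbergSelmer Literature.NumberTheory.EllipticCurves.ZpExtension
  Literature.NumberTheory.EllipticCurves.TwoVariableSelmer Literature.NumberTheory.EllipticCurves.Castella2018
open Summit.BirchSwinnertonDyer.Rank1Residual

namespace Summit.BirchSwinnertonDyer.BirchSwinnertonDyer.Theorems.TwoAdicBDPAcLineSpec

section AnyPrime

variable {K : Type} [Field K] [NumberField K] {p : ℕ} [Fact p.Prime]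

/-- ★ **`hgen` IS A KERNEL THEOREM (any prime `p`).**  `K` imaginary quadratic, `p` SPLIT in `K` (`v ≠ v̄` above
`p`), `κ₂` an ANTICYCLOTOMIC and `κ₁` ANY `ℤ_p`-extension of `K`.  Then there is `φ ∈ Gal(K̄/K_∞^{(2)}) ∩ D_{v̄}`,
the restriction of a Frobenius power `φ₀ ∈ Γ_{K_{v̄}}` of positive degree `m` (`IsFrobPow φ₀ m`, `0 < m`), such
that `φ` and `I′ = pairKer κ₁ κ₂ ∩ I_{v̄}` topologically generate `Gal(K̄/K_∞^{(2)}) ∩ D_{v̄}`: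
`κ₂.kerSubgroup ⊓ decomp v̄ ≤ (Subgroup.closure ({φ} ∪ (pairKer κ₁ κ₂ ⊓ inertia v̄))).topologicalClosure`.
ON PAPER: `Q = (ker κ₂ ∩ D_{v̄})/I′ ↪ D_{v̄}/I_{v̄} ≅ Ẑ` is the open subgroup `f·Ẑ` (`κ₂` ramified at `v̄`,
Brink), procyclic on `Frob^f`; `I′ = ker κ₂ ∩ I_{v̄}` because `K̃_∞/K_∞^{(2)}` is unramified above the split `p`
(local Kronecker–Weber: the inertia group of `Gal(ℚ_p^{ab}/ℚ_p)` is `ℤ_pˣ`, of `ℤ_p`-rank one).  IN THE KERNEL: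
`Literature.GroupTheory.exists_ker_le_topologicalClosure_zpowers_sup_inf` at `(Γ_{K_{v̄}}, I_{K_{v̄}}, Frob, κ₂ ∘ res)`
(`dense_absInertia_mul_zpowers_of_isFrobPow`, `exists_mem_greenbergSelmer_inertia_apply_ne_one_of_isAnticyclotomic`),
pushed forward along `res : Γ_{K_{v̄}} → Γ_K`, with `greenbergSelmer_inertia_inf_kerSubgroup_le_kerSubgroup_of_isAnticyclotomic`.
[cite: NeukirchSchmidtWingberg2008, Thm. 7.5.3] [cite: RibesZalesskii2010, §2.7]
[cite: SerreLocalFields1979, Ch. XIV §7 Thm. 2] [cite: GreenbergLNM1716, §1 p. 53] [cite: Brink2007, Cor. 1 (p. 2136)] -/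
theorem acLineFrobeniusGenerates (hK : IsImaginaryQuadratic K) (κ₁ κ₂ : ZpExtension K p)
    (hκ₂ : κ₂.IsAnticyclotomic) {v vbar : HeightOneSpectrum (𝓞 K)} (hv : ((p : ℕ) : 𝓞 K) ∈ v.asIdeal)
    (hvbar : ((p : ℕ) : 𝓞 K) ∈ vbar.asIdeal) (hne : vbar ≠ v) :
    ∃ φ : absoluteGaloisGroup K, φ ∈ κ₂.kerSubgroup ⊓ decomp vbar ∧
      (∃ (φ₀ : absoluteGaloisGroup (vbar.adicCompletion K)) (m : ℕ), 0 < m ∧ IsFrobPow φ₀ (m : ℤ) ∧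
        absGaloisRestrict K (vbar.adicCompletion K) φ₀ = φ) ∧
      κ₂.kerSubgroup ⊓ decomp vbar ≤ (Subgroup.closure ({φ} ∪
        ((ZpExtension.pairKer κ₁ κ₂ ⊓ inertia vbar : Subgroup (absoluteGaloisGroup K)) :
          Set (absoluteGaloisGroup K)))).topologicalClosure := by
  -- local data at `v̄`
  haveI : CompactSpace (absoluteGaloisGroup (vbar.adicCompletion K)) :=
    absoluteGaloisGroup_compactSpace (vbar.adicCompletion K)
  haveI hIn : (absInertia (vbar.adicCompletion K)).Normal := absInertia_normal_holds (vbar.adicCompletion K)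
  set r := absGaloisRestrict K (vbar.adicCompletion K) with hr_def
  obtain ⟨t, ht⟩ : ∃ t : absoluteGaloisGroup (vbar.adicCompletion K), IsFrobPow t 1 := by
    obtain ⟨σ, hσ⟩ := exists_isAbsArithFrob_holds (vbar.adicCompletion K)
    exact ⟨σ, IsAbsArithFrob.isFrobPow_holds hσ⟩
  -- `cl(⟨t⟩ I) = Γ_{K_v̄}`
  have hdense : closure ((Subgroup.zpowers t ⊔ absInertia (vbar.adicCompletion K) :
      Subgroup (absoluteGaloisGroup (vbar.adicCompletion K))) :
        Set (absoluteGaloisGroup (vbar.adicCompletion K))) = Set.univ := by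
    rw [sup_comm, Subgroup.normal_mul]
    exact (dense_absInertia_mul_zpowers_of_isFrobPow (vbar.adicCompletion K) ht).closure_eq
  -- `λ = κ₂ ∘ res`, ramified on `I`
  set lam : absoluteGaloisGroup (vbar.adicCompletion K) →ₜ* Multiplicative ℤ_[p] :=
    κ₂.toContinuousMonoidHom.comp r with hlam_def
  have hlam : ∀ y, lam y = κ₂ (r y) := fun y => rfl
  have hram : ∃ n ∈ absInertia (vbar.adicCompletion K), lam n ≠ 1 := by
    obtain ⟨τ, hτI, hτ⟩ := exists_mem_greenbergSelmer_inertia_apply_ne_one_of_isAnticyclotomic hK κ₂ hκ₂ hvbar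
    obtain ⟨n, hn, rfl⟩ := Subgroup.mem_map.1 hτI
    exact ⟨n, hn, hτ⟩
  obtain ⟨φ₀, hφ₀, ⟨m, hm, ι, hι, htm⟩, hgen₀⟩ :=
    Literature.GroupTheory.exists_ker_le_topologicalClosure_zpowers_sup_inf
      (absInertia (vbar.adicCompletion K)) (isClosed_absInertia_holds (vbar.adicCompletion K)) t hdense
      lam hram
  -- `φ₀ = t^m ι⁻¹` is a Frobenius power of degree `m`
  have hφ₀frob : IsFrobPow φ₀ (m : ℤ) := by
    have h1 : IsFrobPow (t ^ m) (m : ℤ) := by simpa using ht.pow m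
    have h2 : IsFrobPow ι⁻¹ 0 := by
      simpa using (isFrobPow_zero_iff_mem_absInertia.mpr hι).inv
    have h3 : φ₀ = t ^ m * ι⁻¹ := by rw [htm]; group
    rw [h3]
    simpa using IsFrobPow.mul_holds h1 h2
  refine ⟨r φ₀, Subgroup.mem_inf.2 ⟨mem_kerSubgroup.2 hφ₀, ⟨φ₀, rfl⟩⟩, ⟨φ₀, m, hm, hφ₀frob, rfl⟩, ?_⟩
  -- push `ker λ ≤ cl(⟨φ₀⟩ (ker λ ⊓ I))` forward along `res`
  intro x hx
  obtain ⟨hxk, hxD⟩ := Subgroup.mem_inf.1 hx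
  obtain ⟨y, rfl⟩ := (mem_decomp_iff vbar x).1 hxD
  have hy : y ∈ lam.toMonoidHom.ker := by
    rw [MonoidHom.mem_ker]
    exact mem_kerSubgroup.1 hxk
  have hy' := hgen₀ hy
  set Sloc : Subgroup (absoluteGaloisGroup (vbar.adicCompletion K)) :=
    Subgroup.zpowers φ₀ ⊔ (lam.toMonoidHom.ker ⊓ absInertia (vbar.adicCompletion K)) with hSloc_def
  set Sglob : Subgroup (absoluteGaloisGroup K) := Subgroup.closure ({r φ₀} ∪
    ((ZpExtension.pairKer κ₁ κ₂ ⊓ inertia vbar : Subgroup (absoluteGaloisGroup K)) :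
      Set (absoluteGaloisGroup K))) with hSglob_def
  -- `res(S_loc) ⊆ S_glob`
  have hmap : Sloc.map r.toMonoidHom ≤ Sglob := by
    rw [Subgroup.map_le_iff_le_comap]
    refine sup_le ?_ ?_
    · rw [Subgroup.zpowers_le, Subgroup.mem_comap]
      exact Subgroup.subset_closure (Or.inl rfl)
    · intro z hz
      obtain ⟨hzk, hzI⟩ := Subgroup.mem_inf.1 hz
      rw [Subgroup.mem_comap]
      refine Subgroup.subset_closure (Or.inr ?_)
      have h2 : κ₂ (r z) = 1 := by rw [← hlam]; exact MonoidHom.mem_ker.1 hzk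
      have hzI' : r z ∈ inertia vbar := ⟨z, hzI, rfl⟩
      have h1 : κ₁ (r z) = 1 := mem_kerSubgroup.1
        (greenbergSelmer_inertia_inf_kerSubgroup_le_kerSubgroup_of_isAnticyclotomic hK hκ₂ κ₁ hv hvbar hne
          hvbar (Subgroup.mem_inf.2 ⟨hzI', mem_kerSubgroup.2 h2⟩))
      exact Subgroup.mem_inf.2 ⟨mem_pairKer_iff.2 ⟨h1, h2⟩, hzI'⟩
  -- `res(cl S_loc) ⊆ cl(res S_loc) ⊆ cl S_glob`
  have h1 : r y ∈ r '' closure (Sloc : Set (absoluteGaloisGroup (vbar.adicCompletion K))) := ⟨y, hy', rfl⟩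
  have h2 := image_closure_subset_closure_image r.continuous h1
  exact closure_mono (by rintro _ ⟨z, hz, rfl⟩; exact hmap ⟨z, hz, rfl⟩) h2

/-- ★ **The inertial `τ` of the ordinary shape, Galois side, unconditionally (any `p`)**: at a split prime `p` of a
quadratic field `K` (`v ≠ v̄` above `p`), for any two `ℤ_p`-extensions `κ₁, κ₂` and any torsion unit `u₀ ∈ ℤ_pˣ`
(`u₀ⁿ = 1`, `n ≥ 1`) there is `τ ∈ pairKer κ₁ κ₂ ⊓ inertia v̄` with `χ_p(τ) = u₀` — an element of the inertia
group at `v̄` FIXING `K̃_∞` with prescribed torsion cyclotomic character (local Kronecker–Weber: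
`I(ℚ_p^{ab}/ℚ_p) ≅ ℤ_pˣ`, whose torsion dies in every `ℤ_p`-extension).
[cite: SerreLocalFields1979, Ch. IV §4 Prop. 17] [cite: SerreLocalFields1979, Ch. XIV §7 Thm. 2] -/
theorem exists_mem_pairKer_inf_inertia_cyclotomicCharacter_eq (hK2 : Module.finrank ℚ K = 2)
    (κ₁ κ₂ : ZpExtension K p) {v vbar : HeightOneSpectrum (𝓞 K)} (hv : ((p : ℕ) : 𝓞 K) ∈ v.asIdeal)
    (hvbar : ((p : ℕ) : 𝓞 K) ∈ vbar.asIdeal) (hne : vbar ≠ v) {u₀ : ℤ_[p]ˣ} {n : ℕ} (hn : 0 < n)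
    (hu₀ : u₀ ^ n = 1) :
    ∃ τ : absoluteGaloisGroup K, τ ∈ ZpExtension.pairKer κ₁ κ₂ ∧ τ ∈ inertia vbar ∧
      GaloisRep.cyclotomicCharacter K p τ = u₀ := by
  obtain ⟨τ, hτI, hχ, hall⟩ :=
    exists_mem_greenbergSelmer_inertia_cyclotomicCharacter_eq_of_pow_eq_one hK2 hv hvbar hne hvbar hn hu₀
  exact ⟨τ, mem_pairKer_iff.2 ⟨hall κ₁, hall κ₂⟩, hτI, hχ⟩

end AnyPrime

section Two

variable {K : Type} [Field K] [NumberField K]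

/-- ★ **`hgen` AT `p = 2`, in the letter of GEN 54's door** (`acLineControl_of_ordinaryShape`,
`one_add_le_of_fibrePinned_of_rankOne_of_ordinaryShape`): for `K` imaginary quadratic with `2` split (`v ≠ v̄`
above `2`), `κ₂` anticyclotomic, `κ₁` any: `∃ φ ∈ κ₂.kerSubgroup ⊓ decomp v̄` — the restriction of a local
Frobenius power of positive degree — with
`κ₂.kerSubgroup ⊓ decomp v̄ ≤ (Subgroup.closure ({φ} ∪ (pairKer κ₁ κ₂ ⊓ inertia v̄))).topologicalClosure`.
UNCONDITIONAL: the displayed residual `hgen` of GEN 54 is discharged with ZERO named facts.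
[cite: SerreLocalFields1979, Ch. XIV §7 Thm. 2] [cite: NeukirchSchmidtWingberg2008, Thm. 7.5.3] [cite: Brink2007, Cor. 1 (p. 2136)] -/
theorem acLineFrobeniusGeneratesAtTwo (hK : IsImaginaryQuadratic K) (κ₁ κ₂ : ZpExtension K 2)
    (hκ₂ : κ₂.IsAnticyclotomic) {v vbar : HeightOneSpectrum (𝓞 K)} (hv : ((2 : ℕ) : 𝓞 K) ∈ v.asIdeal)
    (hvbar : ((2 : ℕ) : 𝓞 K) ∈ vbar.asIdeal) (hne : vbar ≠ v) :
    ∃ φ : absoluteGaloisGroup K, φ ∈ κ₂.kerSubgroup ⊓ decomp vbar ∧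
      (∃ (φ₀ : absoluteGaloisGroup (vbar.adicCompletion K)) (m : ℕ), 0 < m ∧ IsFrobPow φ₀ (m : ℤ) ∧
        absGaloisRestrict K (vbar.adicCompletion K) φ₀ = φ) ∧
      κ₂.kerSubgroup ⊓ decomp vbar ≤ (Subgroup.closure ({φ} ∪
        ((ZpExtension.pairKer κ₁ κ₂ ⊓ inertia vbar : Subgroup (absoluteGaloisGroup K)) :
          Set (absoluteGaloisGroup K)))).topologicalClosure :=
  acLineFrobeniusGenerates hK κ₁ κ₂ hκ₂ hv hvbar hne

/-- ★ **The inertial `τ` with `χ₂(τ) = -1` in `pairKer κ₁ κ₂ ⊓ inertia v̄`** (`2` split in the quadratic field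
`K`, `v ≠ v̄` above `2`; any `κ₁, κ₂`): the Galois-side input `(hτ)` of GEN 54's `hord` — on `Ê[2^∞]`, where the
inertia group acts through `χ₂` (Tate), this `τ` acts by `-1`. [cite: SerreLocalFields1979, Ch. XIV §7 Thm. 2]
[cite: SerreLocalFields1979, Ch. IV §4 Prop. 17] -/
theorem exists_mem_pairKer_inf_inertia_cyclotomicCharacter_eq_neg_one (hK2 : Module.finrank ℚ K = 2)
    (κ₁ κ₂ : ZpExtension K 2) {v vbar : HeightOneSpectrum (𝓞 K)} (hv : ((2 : ℕ) : 𝓞 K) ∈ v.asIdeal)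
    (hvbar : ((2 : ℕ) : 𝓞 K) ∈ vbar.asIdeal) (hne : vbar ≠ v) :
    ∃ τ : absoluteGaloisGroup K, τ ∈ ZpExtension.pairKer κ₁ κ₂ ∧ τ ∈ inertia vbar ∧
      GaloisRep.cyclotomicCharacter K 2 τ = -1 :=
  exists_mem_pairKer_inf_inertia_cyclotomicCharacter_eq hK2 κ₁ κ₂ hv hvbar hne (u₀ := -1) (n := 2)
    two_pos (by rw [neg_sq, one_pow])

/-- ★ **THE DOOR WITH `hgen` DISCHARGED** (`p = 2`): GEN 54's `acLineControl_of_ordinaryShape` with the binders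
`(φ) (hφ) (hgen)` REPLACED by the split frame `(v) (hv) (hne)` + `κ₂.IsAnticyclotomic`, the ordinary shape now asked
only AT RESTRICTIONS OF LOCAL FROBENIUS POWERS OF POSITIVE DEGREE (`hordFrob`; this is what Tate's ordinary
filtration delivers: `ψ(φ₀) = α^m ≠ 1`).  Conclusion = the door's control input `hctl` at
`(W.baseChange K, 2, κ₁, κ₂, v̄, γ₁)` VERBATIM.  [cite: SkinnerUrban2014, Prop. 3.2.8 (p. 23)]
[cite: SerreLocalFields1979, Ch. XIV §7 Thm. 2] [cite: GreenbergLNM1716, §2] -/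
theorem acLineControl_of_ordinaryShapeAtFrobPow (W : WeierstrassCurve ℚ) [W.IsElliptic]
    (K : Type) [Field K] [NumberField K] (hK : IsImaginaryQuadratic K)
    (κ₁ κ₂ : ZpExtension K 2) (γ₁ γ₂ : absoluteGaloisGroup K) [Fact (ZpExtension.IsTopGeneratorPair κ₁ κ₂ γ₁ γ₂)]
    (hκ₂ : κ₂.IsAnticyclotomic) {v vbar : HeightOneSpectrum (𝓞 K)} (hv : ((2 : ℕ) : 𝓞 K) ∈ v.asIdeal)
    (hvbar : ((2 : ℕ) : 𝓞 K) ∈ vbar.asIdeal) (hne : vbar ≠ v)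
    (hordFrob : ∀ (φ₀ : absoluteGaloisGroup (vbar.adicCompletion K)) (m : ℕ), 0 < m → IsFrobPow φ₀ (m : ℤ) →
      ∃ F : AddSubgroup ((W.baseChange K).geomPrimaryTorsion 2),
        (∃ τ : absoluteGaloisGroup K, τ ∈ ZpExtension.pairKer κ₁ κ₂ ∧ τ ∈ inertia vbar ∧ ∀ n ∈ F, τ • n = -n) ∧
        ∃ v : ℕ, ∀ m : (W.baseChange K).geomPrimaryTorsion 2, ∃ j : ℤ,
          absGaloisRestrict K (vbar.adicCompletion K) φ₀ • (j • m) - j • m - 2 ^ v • m ∈ F) :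
    ∃ m : ℕ, ∀ s : unrSelmer₂ κ₁ κ₂ ((W.baseChange K).geomPrimaryTorsion 2) vbar,
      conjSel₂ κ₁ κ₂ ((W.baseChange K).geomPrimaryTorsion 2) vbar γ₁ s = s →
        2 ^ m • s ∈ Set.range ((W.baseChange K).selmerAcToUnrSelmer₂ 2 κ₁ κ₂ vbar) := by
  obtain ⟨φ, hφ, ⟨φ₀, m, hm, hfrob, hφ₀⟩, hgen⟩ := acLineFrobeniusGeneratesAtTwo hK κ₁ κ₂ hκ₂ hv hvbar hne
  obtain ⟨F, hτ, hu⟩ := hordFrob φ₀ m hm hfrob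
  rw [hφ₀] at hu
  exact acLineControl_of_ordinaryShape W K hK κ₁ κ₂ γ₁ γ₂ vbar hvbar φ hφ hgen ⟨F, hτ, hu⟩

end Two

section Inequality

variable (W : WeierstrassCurve ℚ) [W.IsElliptic] [W.IsGloballyMinimal]
  {K : Type} [Field K] [NumberField K]
  (κ₁ κ₂ : ZpExtension K 2) (vbar : HeightOneSpectrum (𝓞 K)) (γ₁ γ₂ : absoluteGaloisGroup K)
  [Fact (ZpExtension.IsTopGeneratorPair κ₁ κ₂ γ₁ γ₂)] [Fact (κ₂.IsTopGenerator γ₂)]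
  (J : ℤ_[2] →+* PadicComplexInt 2) (C₀ : IwasawaAlgebra₂ 2) (G : PowerSeries (PowerSeries (PadicComplexInt 2)))
  (hpin : ∃ 𝔓 : Ideal (PowerSeries (PowerSeries (IsLocalRing.ResidueField (PadicComplexInt 2)))),
    𝔓.IsPrime ∧ PowerSeries.map (PowerSeries.map (IsLocalRing.residue (PadicComplexInt 2))) G ∉ 𝔓 ∧
    ∀ (a : ℕ) (C₁ : PowerSeries (PowerSeries (PadicComplexInt 2))),
      IwasawaAlgebra₂.toUnr₂ 2 J C₀ = (2 : PowerSeries (PowerSeries (PadicComplexInt 2))) ^ a * C₁ →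
      PowerSeries.map (PowerSeries.map (IsLocalRing.residue (PadicComplexInt 2))) C₁ ≠ 0 →
      PowerSeries.map (PowerSeries.map (IsLocalRing.residue (PadicComplexInt 2))) C₁ ∈
        𝔓 ⊔ Ideal.span {PowerSeries.map (PowerSeries.map (IsLocalRing.residue (PadicComplexInt 2))) G})
  (hG0 : PowerSeries.constantCoeff (PowerSeries.constantCoeff G) ∈ IsLocalRing.maximalIdeal (PadicComplexInt 2))
  (a : ℕ) (C₁ : PowerSeries (PowerSeries (PadicComplexInt 2)))
  (hC : IwasawaAlgebra₂.toUnr₂ 2 J C₀ = (2 : PowerSeries (PowerSeries (PadicComplexInt 2))) ^ a * C₁)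
  (hC₁ : PowerSeries.map (PowerSeries.map (IsLocalRing.residue (PadicComplexInt 2))) C₁ ≠ 0)

include hpin hG0 hC hC₁

/-- ★ **(e15) ON THE HABITAT'S RANK-ONE DATA with `hgen` DISCHARGED** (`p = 2`): GEN 54's
`one_add_le_of_fibrePinned_of_rankOne_of_ordinaryShape` with `(φ) (hφ) (hgen)` replaced by the second prime
`v ≠ v̄` above `2` (the split frame already carried as `hsplit`) — the pinning datum, LINK A₂'s binders and the ordinary
shape AT FROBENIUS POWERS give `m`, `k`, a unit `u` with `(J C₀)(0,0) ∣ 2^{k+m}·u` and **`1 + a ≤ k + m`**, now modulo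
the curve-side `hordFrob` ALONE. [folklore] -/
theorem one_add_le_of_fibrePinned_of_rankOne_of_ordinaryShapeAtFrobPow (hK : IsImaginaryQuadratic K)
    (hsplit : X11b.SplitsIn K 2) (hκ₂ : κ₂.IsAnticyclotomic) {v : HeightOneSpectrum (𝓞 K)}
    (hv : ((2 : ℕ) : 𝓞 K) ∈ v.asIdeal) (hvbar : ((2 : ℕ) : 𝓞 K) ∈ vbar.asIdeal) (hne : vbar ≠ v)
    (hrank : (W.baseChange K).mordellWeilRank = 1)
    (hsha : Finite (AddCommGroup.primaryComponent (W.baseChange K).sha 2))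
    (hordFrob : ∀ (φ₀ : absoluteGaloisGroup (vbar.adicCompletion K)) (m : ℕ), 0 < m → IsFrobPow φ₀ (m : ℤ) →
      ∃ F : AddSubgroup ((W.baseChange K).geomPrimaryTorsion 2),
        (∃ τ : absoluteGaloisGroup K, τ ∈ ZpExtension.pairKer κ₁ κ₂ ∧ τ ∈ inertia vbar ∧ ∀ n ∈ F, τ • n = -n) ∧
        ∃ v : ℕ, ∀ m : (W.baseChange K).geomPrimaryTorsion 2, ∃ j : ℤ,
          absGaloisRestrict K (vbar.adicCompletion K) φ₀ • (j • m) - j • m - 2 ^ v • m ∈ F)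
    (hC₀ : XGr₂.charIdeal (W.baseChange K) 2 κ₁ κ₂ vbar γ₁ γ₂ = Ideal.span {C₀}) :
    ∃ (m k : ℕ) (u : PadicComplexInt 2), AcSelmer.XAc.HasCharValuationAt (W.baseChange K) 2 κ₂ vbar ∅ γ₂ m ∧
      IsUnit u ∧ PowerSeries.constantCoeff (PowerSeries.constantCoeff (IwasawaAlgebra₂.toUnr₂ 2 J C₀)) ∣
        (2 : PadicComplexInt 2) ^ (k + m) * u ∧ 1 + a ≤ k + m := by
  obtain ⟨φ, hφ, ⟨φ₀, m, hm, hfrob, hφ₀⟩, hgen⟩ := acLineFrobeniusGeneratesAtTwo hK κ₁ κ₂ hκ₂ hv hvbar hne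
  obtain ⟨F, hτ, hu⟩ := hordFrob φ₀ m hm hfrob
  rw [hφ₀] at hu
  exact one_add_le_of_fibrePinned_of_rankOne_of_ordinaryShape W κ₁ κ₂ vbar γ₁ γ₂ J C₀ G hpin hG0 a C₁ hC hC₁
    hK hsplit hκ₂ hvbar hrank hsha φ hφ hgen ⟨F, hτ, hu⟩ hC₀

end Inequality

end Summit.BirchSwinnertonDyer.BirchSwinnertonDyer.Theorems.TwoAdicBDPAcLineSpec

end
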